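import Literature.MathematicalPhysics.QuantumFieldTheory.Balaban1983to89.B16Ineq17LocalFederbush
import Literature.MathematicalPhysics.QuantumFieldTheory.Balaban1983to89.B15Prop1SliceIneq167

/-!
# `Balaban1983to89.B16Ineq17LocalFederbushSlice` — [Balaban1989LargeFieldII] (1.7) p. 358 at flat background with `γ₀ = 1`, READ ON
# THE `x₁`-SLICE OF RECORD of the N12∕s1 chain ([Balaban1989LargeFieldI] Prop. 1 p. 194): the window circulation sum of the
# gauge-fixed coordinates `X ∈ GaugeSlice (pts k Λ) T ℝ³` is dominated, with constant `1`, by the flat leading form — the (1.7) LETTER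
# `h17` of the γ₀-generic root `B15Prop1LocalLettersSU2Box.prop1Printed_lfVarOn_su2_box_G0_of_17_ext193_local` fed at `γ₀ = 1`

statement-level skeleton of published theorems with citation tags; proofs where landed; nothing here is a claim about
the Yang–Mills mass gap.

T. Bałaban, *Large field renormalization. II*, Commun. Math. Phys. **122** (1989) 355–392 [Balaban1989LargeFieldII], (1.7)–(1.9)
p. 358 (renders `…-p003∕p004-x2.png` re-read by this seat); T. Bałaban, *Large field renormalization. I*, Commun. Math. Phys. **122**
(1989) 175–202 [Balaban1989LargeFieldI], Prop. 1 (1.77)–(1.78) p. 194; T. Bałaban, *Propagators and renormalization transformations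
… I*, Commun. Math. Phys. **95** (1984) 17–40 [Balaban1984PropagatorsI], (1.66)–(1.67) p. 29; P. Federbush, Commun. Math. Phys. **107**
(1986) 319–329 [Federbush1986PhaseCellI], 'Abelian Stability Theorem' (0.12) p. 321.

Cell pub-ymgap, HUMAN RULING D-0062 ∕ D-0149, seat `pub-ymgap-dag-n12-w4` (WIDTH SEAT 4 of DAG node N12 = [B15]; START-LIST §N12 item 4 =
U2c; key K1⁷ stmt-QuantumFields-20542, helper, count-neutral).  Sequel of `B16Ineq17LocalFederbush` (p584067): there (1.7) at
flat background is delivered in r02's torus currency (`d1Sq Mt B′`) and on p26's box chart; HERE it is read in the binders of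
the N12∕s1 chain's slice of record (dag-n12-c, `B15Prop1SliceCoordinates` ∕ `B15Prop1SliceIneq167` ∕ `B15Prop1LocalLettersSU2Box`):
`X : GaugeSlice (pts k Λ) T (EuclideanSpace ℝ (Fin 3))`, its zero extension `ιA … X`, the torus of `Setup` read as r02's
`Tor (fun _ => sitesPerDir k)`, the `x₁`-axial window circulation sum `Σ_{z∈window} Σ_μ Σ_a (∂(ιA X)_a)(z; e₀, e_μ)²` of
`B15Prop1SliceIneq18.sliceNormSq_le`.

WHAT THIS FILE PROVES (THEOREMS ONLY — no `def`, no new `… : Prop`, no `sorry`; axioms standard; BY NAME: n12-c's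
`B15Prop1SliceIneq167.sum_axial_le_d1Sq` ∕ `tcurl_ofRealCfg_castSite`, `T4AxialGaugeSmallField.castSite_injOn_box`, p584067's
`B16Ineq17LocalFederbush.d1Sq_le_weighted_of_blocks` ∕ `ineq17_flat_of_le`, β sub-cell `Beta.MonotoneScales.formDk_one`).
§1 ★ `circ_le_sum_d1Sq` — the window circulation sum of ANY `ℝ³`-valued bond field of `Setup` is dominated WITH CONSTANT `1` by
   `Σ_a ⟨∂₁Ã_a, ∂₁Ã_a⟩ = Σ_a d1Sq Mt (ofRealCfg (fun j => A ⟨j.1, j.2⟩ a))` on the torus `Mt = fun _ => sitesPerDir k` (no wrapping of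
   the window) — n12-c's `circ_le_sum_formDk` with its last step `(4/π²)^{d+2}·d1Sq ≤ formDk n′` ((1.67) [10]) REMOVED: the axial
   components are among all components (`sum_axial_le_d1Sq`); `circ_le_sum_formDk_one` — the same against `Σ_a formDk 1 Mt …`
   (`formDk 1 = d1Sq`).
§2 ★★ `h17_one_of_sum_d1Sq_le` — THE ROOT (1.7) LETTER AT `γ₀ = 1`: for `X ∈ GaugeSlice S T ℝ³`, any window without wrapping and
   any real `Qv` (the consumer's `⟪H X, Δ₁(H X)⟫`) with `Qv = Q♭ + E_A`, `Σ_a d1Sq Mt (ofRealCfg (ιA-coordinates of X)_a) ≤ Q♭`,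
   `|E_A| ≤ Cerr·‖X‖²`: `1·circ(X) − Cerr·‖X‖² ≤ Qv`; `h17_one_of_sum_d1Sq_le_window` — literally the window
   `box ((hi − lo + 1).toNat + 3) (lo − 2)` of the root :292 under its side condition `(hi − lo + 1).toNat + 5 < sitesPerDir k`.
§3 `plaq_ofRealCfg_ιA_eq_zero_of_not_mem` — for the box of record `pts k Λ = castSite '' Icc lo hi`, the plaquette variables (`μ ≠ ν`) of every
   coordinate field `(ιA X)_a` vanish off `castSite '' Icc (lo − 1) hi` (private dictionary: `castSite_add'`, `castSite_unitVec'`,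
   `shift_eq_add_unitVec'`).
§4 ★★ `h17_one_of_flat_blocks` — §2 fed by p584067: per 𝔤-coordinate `a` a fine field `A_a` on B5's fine torus
   `Tor (fine n Mt)` whose `B5Block118.QvOp`-averages reproduce the slice coordinates on a set `S` of unit plaquettes carrying the
   curl of the slice field, weights `ζ ≥ 0` that are `≥ 1` on the blocks of a `T ⊇` the four corners of every plaquette of `S`,
   and `Q♭ ≥ Σ_a η^d·½Σ_{μ,ν}Σ_x ζ_{μν}(x)‖F^η_{μν}(A_a)(x)‖²` ⇒ the `h17` body at `γ₀ = 1`; ★★ `h17_one_of_flat_blocks_box` — the same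
   for the box of record with the support hypothesis discharged by §3 (`S₁ ⊇` the image of `Icc (lo − 1) hi`).

HONEST SCOPE.  (i) Junction bookkeeping: the circulation ↔ torus-curl dictionary is n12-c's (cited), the flat-route inequality is
p584067's; nothing of Bałaban's is asserted.  (ii) Displayed, NOT discharged: the splitting `Qv = Q♭ + E_A` with U2a's flat
leading form and letter (b) `|E_A| ≤ Cerr‖X‖²` ([LF-II] p. 357 «expand … with respect to A₀, up to the first order»), U2b's
«averages of `H⁰_{1,k,Z}X` = `X` near `Λ`» in `QvOp` currency, and the junction of B5's corner-block fine torus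
`Tor (fine n Mt)` with NODE 00's centred blocks on `Site (F.P Kt) 0` (Setup DIVERGENCE F3) — the latter is NOT typed anywhere yet.
(iii) What the file feeds: the `h17` letter (γ₀ generic) of `B15Prop1LocalLettersSU2Box.prop1Printed_lfVarOn_su2_box_G0_of_17_ext193_local`
at `γ₀ := 1` for a model-level instance, resp. the root of a one-sided edition of the `hlead` chain; the two-sided `hlead` of
`B15Prop1Thm1GeneralFormShapes` §4 is NOT implied (print's route, letters (a)+(c) of r13).  Count-neutral; N12 NOT discharged; one
finite 𝕋⁴ programme at fixed `ε`; R4 closes the conditional rung `BalabanLadder.UV` only; nothing continuum ∕ ℝ⁴ ∕ OS ∕ mass gap ∕ Clay.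
-/

noncomputable section

open Set Finset
open scoped BigOperators Matrix RealInnerProductSpace Real

namespace Literature.MathematicalPhysics.QuantumFieldTheory.Balaban1983to89.B16Ineq17LocalFederbushSlice

open B15DeterminingSets GaugeField B15Prop1Carrier B8Eq17ClassAkV1
open B15Prop1SliceCoordinates (GaugeSlice ιA freeBonds mem_freeBonds ιA_apply_of_not_mem)
open T4AxialGaugeSmallField (castSite castSite_apply castSite_injOn_box)
open B6BondElimination (unitVec unitVec_apply)
open B6TreeGaugePoincare (curl)
open B16Eq18Proof (box mem_box)
open B5Prop11Plancherel (Tor fine)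
open B5Bounds167Lattice (d1Sq formDk ofRealCfg)
open B5Action121 (Fs)
open B5Block118 (tstep bpt QvOp)
open B5AverageCurlStokes (plaq plaq_apply)
open B15Prop1SliceIneq167 (sum_axial_le_d1Sq tcurl_ofRealCfg_castSite)
open B16Ineq17LocalFederbush (d1Sq_le_weighted_of_blocks ineq17_flat_of_le curl_eq_plaq)

variable {P : Params} {k : ℕ}

/-! ## §1  The window circulation sum is dominated by `Σ_a ⟨∂₁Ã_a, ∂₁Ã_a⟩` with constant `1` -/

section Circ

/-- **WINDOW → TORUS** (re-proof of n12-c's private helper): a non-negative function summed over the `castSite`-image of an integer box with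
at most `sitesPerDir` sites per direction (no wrapping, `castSite` injective on it) is at most its sum over the whole torus.
[cite: Balaban1989LargeFieldII, (1.8) p.358] -/
private theorem sum_box_castSite_le_sum_univ {m : Fin P.d → ℕ} (lo : Fin P.d → ℤ) (hm : ∀ κ, (m κ : ℤ) ≤ P.sitesPerDir k)
    (g : Tor (fun _ : Fin P.d => P.sitesPerDir k) → ℝ) (hg : ∀ x, 0 ≤ g x) :
    ∑ z ∈ box m lo, g (castSite (j := k) z) ≤ ∑ x : Tor (fun _ : Fin P.d => P.sitesPerDir k), g x := by
  classical
  have hinj : Set.InjOn (fun z : Fin P.d → ℤ => castSite (P := P) (j := k) z) ↑(box m lo) := by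
    intro x hx x' hx' h
    rw [Finset.mem_coe, mem_box] at hx hx'
    refine castSite_injOn_box (j := k) (lo := lo) (hi := fun κ => lo κ + m κ - 1) (fun κ => ?_)
      (fun κ => (hx κ).1) (fun κ => ?_) (fun κ => (hx' κ).1) (fun κ => ?_) h
    · have := hm κ
      show lo κ + (m κ : ℤ) - 1 - lo κ < (P.sitesPerDir k : ℤ)
      omega
    · have := (hx κ).2
      show x κ ≤ lo κ + (m κ : ℤ) - 1
      omega
    · have := (hx' κ).2
      show x' κ ≤ lo κ + (m κ : ℤ) - 1
      omega
  rw [← Finset.sum_image hinj]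
  exact Finset.sum_le_univ_sum_of_nonneg hg

/-- ★ **THE `x₁`-AXIAL WINDOW CIRCULATION SUM ≤ `Σ_a ⟨∂₁Ã_a, ∂₁Ã_a⟩`, CONSTANT `1`.**  For every bond field `A` of `Setup` with values in `ℝ³`
(the Lie algebra coordinates of `su(2)`), every window `box m lo` without wrapping (`m_κ ≤ sitesPerDir k`):
`Σ_{z∈window} Σ_μ Σ_a (∂A_a)(z; e₀, e_μ)² ≤ Σ_a d1Sq Mt Ã_a`, `Ã_a = ofRealCfg (A(·)_a)` on the torus `Mt = fun _ => sitesPerDir k` — the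
axial curl components at the window's plaquettes are among all curl components at all plaquettes (`sum_axial_le_d1Sq` ∘
`tcurl_ofRealCfg_castSite`, n12-c).  This is `B15Prop1SliceIneq167.circ_le_sum_formDk` WITHOUT its (1.67) step.
[cite: Balaban1989LargeFieldII, (1.7)–(1.8) p.358; Balaban1984PropagatorsI, (1.66) p.29] -/
theorem circ_le_sum_d1Sq (h0 : 0 < P.d) {m : Fin P.d → ℕ} (lo : Fin P.d → ℤ) (hm : ∀ κ, (m κ : ℤ) ≤ P.sitesPerDir k)
    (A : VecField P k (EuclideanSpace ℝ (Fin 3))) :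
    ∑ z ∈ box m lo, ∑ μ : Fin P.d, ∑ a : Fin 3, curl (fun b => A ⟨castSite b.1, b.2⟩ a) z ⟨0, h0⟩ μ ^ 2 ≤
      ∑ a : Fin 3, d1Sq (fun _ : Fin P.d => P.sitesPerDir k)
        (ofRealCfg (fun _ : Fin P.d => P.sitesPerDir k) fun i => A ⟨i.1, i.2⟩ a) := by
  have hre : ∑ z ∈ box m lo, ∑ μ : Fin P.d, ∑ a : Fin 3, curl (fun b => A ⟨castSite b.1, b.2⟩ a) z ⟨0, h0⟩ μ ^ 2 =
      ∑ a : Fin 3, ∑ μ : Fin P.d, ∑ z ∈ box m lo, curl (fun b => A ⟨castSite b.1, b.2⟩ a) z ⟨0, h0⟩ μ ^ 2 :=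
    calc ∑ z ∈ box m lo, ∑ μ : Fin P.d, ∑ a : Fin 3, curl (fun b => A ⟨castSite b.1, b.2⟩ a) z ⟨0, h0⟩ μ ^ 2
        = ∑ z ∈ box m lo, ∑ a : Fin 3, ∑ μ : Fin P.d, curl (fun b => A ⟨castSite b.1, b.2⟩ a) z ⟨0, h0⟩ μ ^ 2 :=
          Finset.sum_congr rfl fun _ _ => Finset.sum_comm
      _ = ∑ a : Fin 3, ∑ z ∈ box m lo, ∑ μ : Fin P.d, curl (fun b => A ⟨castSite b.1, b.2⟩ a) z ⟨0, h0⟩ μ ^ 2 :=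
          Finset.sum_comm
      _ = ∑ a : Fin 3, ∑ μ : Fin P.d, ∑ z ∈ box m lo, curl (fun b => A ⟨castSite b.1, b.2⟩ a) z ⟨0, h0⟩ μ ^ 2 :=
          Finset.sum_congr rfl fun _ _ => Finset.sum_comm
  rw [hre]
  refine Finset.sum_le_sum fun a _ => ?_
  set Ba : Tor (fun _ : Fin P.d => P.sitesPerDir k) × Fin P.d → ℂ :=
    ofRealCfg (fun _ : Fin P.d => P.sitesPerDir k) fun i => A ⟨i.1, i.2⟩ a with hBa
  have hwin : ∑ μ : Fin P.d, ∑ z ∈ box m lo, curl (fun b => A ⟨castSite b.1, b.2⟩ a) z ⟨0, h0⟩ μ ^ 2 ≤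
      ∑ μ : Fin P.d, ∑ x : Tor (fun _ : Fin P.d => P.sitesPerDir k),
        ‖B5Bounds167Lattice.curl (fun _ : Fin P.d => P.sitesPerDir k) Ba ⟨0, h0⟩ μ x‖ ^ 2 := by
    refine Finset.sum_le_sum fun μ _ => ?_
    have hle := sum_box_castSite_le_sum_univ lo hm
      (fun x => ‖B5Bounds167Lattice.curl (fun _ : Fin P.d => P.sitesPerDir k) Ba ⟨0, h0⟩ μ x‖ ^ 2) fun x => by positivity
    refine le_trans (le_of_eq (Finset.sum_congr rfl fun z _ => ?_)) hle
    rw [hBa, tcurl_ofRealCfg_castSite A a z ⟨0, h0⟩ μ, Complex.norm_real, Real.norm_eq_abs, sq_abs]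
  exact hwin.trans (sum_axial_le_d1Sq (fun _ : Fin P.d => P.sitesPerDir k) Ba ⟨0, h0⟩)

/-- **The same against `Σ_a formDk 1 Mt …`** (`formDk 1 = d1Sq`, β sub-cell `Beta.MonotoneScales.formDk_one`): the slice-currency
reading of «`hlead` at `n′ = 1` needs no (1.67)». [cite: Balaban1984PropagatorsI, (1.66)–(1.67) p.29; Balaban1989LargeFieldII, (1.7) p.358] -/
theorem circ_le_sum_formDk_one (h0 : 0 < P.d) {m : Fin P.d → ℕ} (lo : Fin P.d → ℤ) (hm : ∀ κ, (m κ : ℤ) ≤ P.sitesPerDir k)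
    (A : VecField P k (EuclideanSpace ℝ (Fin 3))) :
    ∑ z ∈ box m lo, ∑ μ : Fin P.d, ∑ a : Fin 3, curl (fun b => A ⟨castSite b.1, b.2⟩ a) z ⟨0, h0⟩ μ ^ 2 ≤
      ∑ a : Fin 3, formDk 1 (fun _ : Fin P.d => P.sitesPerDir k)
        (ofRealCfg (fun _ : Fin P.d => P.sitesPerDir k) fun i => A ⟨i.1, i.2⟩ a) := by
  refine (circ_le_sum_d1Sq h0 lo hm A).trans (le_of_eq (Finset.sum_congr rfl fun a _ => ?_))
  rw [Beta.MonotoneScales.formDk_one]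

end Circ

/-! ## §2  The root (1.7) letter `h17` at `γ₀ = 1` -/

section Root

variable [DecidableEq (PBond P k)]

/-- ★★ **THE (1.7) LETTER OF THE γ₀-GENERIC ROOT, AT `γ₀ = 1`.**  For gauge-fixed coordinates `X ∈ GaugeSlice S T ℝ³` of the N12∕s1
chain, a window `box m lo` without wrapping and ANY real `Qv` — the consumer's quadratic form `⟪H X, Δ₁(H X)⟫` of [LF-II] (1.2) — that
splits as `Qv = Q♭ + E_A` with the flat leading form dominating `Σ_a ⟨∂₁X̃_a, ∂₁X̃_a⟩ = Σ_a d1Sq Mt (ofRealCfg (ιA-coordinates)_a)`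
(p584067 delivers this from ANY fine field averaging to `X` near `Λ`) and the first-order `A₀`-expansion letter `|E_A| ≤ Cerr·‖X‖²`:
`1·circ(X) − Cerr·‖X‖² ≤ Qv` — the body of the hypothesis `h17` of
`B15Prop1LocalLettersSU2Box.prop1Printed_lfVarOn_su2_box_G0_of_17_ext193_local` with `γ₀ := 1`.
[cite: Balaban1989LargeFieldII, (1.7) pp.357–358; Balaban1989LargeFieldI, Prop. 1 (1.77)–(1.78) p.194] -/
theorem h17_one_of_sum_d1Sq_le (h0 : 0 < P.d) {S : Set (Site P k)} {T : Finset (PBond P k)}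
    (X : GaugeSlice S T (EuclideanSpace ℝ (Fin 3))) {m : Fin P.d → ℕ} (lo : Fin P.d → ℤ)
    (hm : ∀ κ, (m κ : ℤ) ≤ P.sitesPerDir k) {Qv Qflat EA Cerr : ℝ} (hQ : Qv = Qflat + EA)
    (hflat : ∑ a : Fin 3, d1Sq (fun _ : Fin P.d => P.sitesPerDir k)
      (ofRealCfg (fun _ : Fin P.d => P.sitesPerDir k) fun i => ιA S T X ⟨i.1, i.2⟩ a) ≤ Qflat)
    (hEA : |EA| ≤ Cerr * ‖X‖ ^ 2) :
    1 * (∑ z ∈ box m lo, ∑ μ : Fin P.d, ∑ a : Fin 3,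
        curl (fun b => ιA S T X (⟨castSite b.1, b.2⟩ : PBond P k) a) z ⟨0, h0⟩ μ ^ 2) - Cerr * ‖X‖ ^ 2 ≤ Qv := by
  have hcirc := circ_le_sum_d1Sq h0 lo hm (ιA S T X)
  have h1 := (abs_le.mp hEA).1
  rw [hQ, one_mul]
  linarith

/-- **The window of the root, literally**: for the box `pts k Λ = castSite '' Icc lo hi` with the root's side condition
`(hi − lo + 1).toNat + 5 < sitesPerDir k`, the root's window `box ((hi − lo + 1).toNat + 3) (lo − 2)` does not wrap, and §2 reads with
that window. [cite: Balaban1989LargeFieldII, (1.7)–(1.8) p.358] -/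
theorem h17_one_of_sum_d1Sq_le_window (h0 : 0 < P.d) {S : Set (Site P k)} {T : Finset (PBond P k)}
    (X : GaugeSlice S T (EuclideanSpace ℝ (Fin 3))) (lo hi : Fin P.d → ℤ)
    (hN5 : ∀ κ, ((hi κ - lo κ + 1).toNat : ℤ) + 5 < P.sitesPerDir k) {Qv Qflat EA Cerr : ℝ} (hQ : Qv = Qflat + EA)
    (hflat : ∑ a : Fin 3, d1Sq (fun _ : Fin P.d => P.sitesPerDir k)
      (ofRealCfg (fun _ : Fin P.d => P.sitesPerDir k) fun i => ιA S T X ⟨i.1, i.2⟩ a) ≤ Qflat)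
    (hEA : |EA| ≤ Cerr * ‖X‖ ^ 2) :
    1 * (∑ z ∈ box (fun κ => (hi κ - lo κ + 1).toNat + 3) (fun κ => lo κ - 2), ∑ μ : Fin P.d, ∑ a : Fin 3,
        curl (fun b => ιA S T X (⟨castSite b.1, b.2⟩ : PBond P k) a) z ⟨0, h0⟩ μ ^ 2) - Cerr * ‖X‖ ^ 2 ≤ Qv :=
  h17_one_of_sum_d1Sq_le h0 X (fun κ => lo κ - 2) (fun κ => by push_cast; have := hN5 κ; omega) hQ hflat hEA

end Root


/-! ## §3  Where the curl of the zero-extended slice field lives -/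

section Support

/-- `castSite` is additive. [folklore] -/
private theorem castSite_add' (z w : Fin P.d → ℤ) :
    (castSite (z + w) : Site P k) =
      @HAdd.hAdd (Tor (fun _ : Fin P.d => P.sitesPerDir k)) (Tor (fun _ : Fin P.d => P.sitesPerDir k))
        (Tor (fun _ : Fin P.d => P.sitesPerDir k)) _ (castSite (j := k) z) (castSite (j := k) w) := by
  funext κ
  simp [castSite_apply]

/-- `castSite` of the `ℤ^d` unit vector is the torus unit vector. [folklore] -/
private theorem castSite_unitVec' (μ : Fin P.d) :
    (castSite (B6BondElimination.unitVec μ) : Site P k) = B5Prop11Plancherel.unitVec (fun _ : Fin P.d => P.sitesPerDir k) μ := by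
  funext κ
  by_cases h : κ = μ
  · subst h; simp [castSite_apply, B6BondElimination.unitVec_apply, B5Prop11Plancherel.unitVec]
  · simp [castSite_apply, B6BondElimination.unitVec_apply, B5Prop11Plancherel.unitVec, h]

/-- One lattice step of `Setup` is the torus unit step. [folklore] -/
private theorem shift_eq_add_unitVec' (x : Site P k) (μ : Fin P.d) :
    (x.shift μ : Site P k) =
      @HAdd.hAdd (Tor (fun _ : Fin P.d => P.sitesPerDir k)) (Tor (fun _ : Fin P.d => P.sitesPerDir k))
        (Tor (fun _ : Fin P.d => P.sitesPerDir k)) _ x (B5Prop11Plancherel.unitVec (fun _ : Fin P.d => P.sitesPerDir k) μ) := by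
  funext κ
  by_cases h : κ = μ
  · subst h; simp [Site.shift, B5Prop11Plancherel.unitVec]
  · simp [Site.shift, B5Prop11Plancherel.unitVec, h]

variable [DecidableEq (PBond P k)]

/-- **WHERE `∂₁` OF THE ZERO-EXTENDED SLICE FIELD LIVES**: for the box of record `pts k Λ = castSite '' Icc lo hi` and coordinates
`X ∈ GaugeSlice (castSite '' Icc lo hi) T ℝ³`, the plaquette variables (`μ ≠ ν`) of every coordinate field `(ιA X)_a`, read on r02's torus,
VANISH at every unit plaquette `q` off `castSite '' Icc (lo − 1) hi` (a plaquette at `q` reads bonds with endpoints among `q`, `q + e_μ`,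
`q + e_ν`, `q + e_μ + e_ν`; `ιA X` vanishes off the bonds meeting `Λ`, `B15Prop1SliceCoordinates.ιA_apply_of_not_mem`) — the set `S`
of `B16Ineq17LocalFederbush.d1Sq_le_weighted_of_blocks` for the slice field. [cite: Balaban1989LargeFieldII, (1.8) p.358, p.359] -/
theorem plaq_ofRealCfg_ιA_eq_zero_of_not_mem {lo hi : Fin P.d → ℤ} {T : Finset (PBond P k)}
    (X : GaugeSlice (castSite '' Set.Icc lo hi : Set (Site P k)) T (EuclideanSpace ℝ (Fin 3))) (a : Fin 3)
    {μ ν : Fin P.d} (hμν : μ ≠ ν) {q : Tor (fun _ : Fin P.d => P.sitesPerDir k)}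
    (hq : (q : Site P k) ∉ (castSite '' Set.Icc (lo - 1) hi : Set (Site P k))) :
    plaq (fun _ : Fin P.d => P.sitesPerDir k)
      (ofRealCfg (fun _ : Fin P.d => P.sitesPerDir k)
        fun i => ιA (castSite '' Set.Icc lo hi : Set (Site P k)) T X ⟨i.1, i.2⟩ a) μ ν q = 0 := by
  -- every site `q + w̄`, `w ∈ {0,1}^d`, lies off `castSite '' Icc lo hi`
  have key : ∀ w : Fin P.d → ℤ, (∀ i, w i = 0 ∨ w i = 1) →
      (@HAdd.hAdd (Tor (fun _ : Fin P.d => P.sitesPerDir k)) (Tor (fun _ : Fin P.d => P.sitesPerDir k))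
        (Tor (fun _ : Fin P.d => P.sitesPerDir k)) _ q (castSite (j := k) w) : Site P k)
        ∉ (castSite '' Set.Icc lo hi : Set (Site P k)) := by
    intro w hw hmem
    obtain ⟨z, hz, hzq⟩ := hmem
    apply hq
    refine ⟨z - w, ⟨fun i => ?_, fun i => ?_⟩, ?_⟩
    · have h1 : lo i ≤ z i := hz.1 i
      simp only [Pi.sub_apply, Pi.one_apply]
      rcases hw i with h | h <;> · rw [h]; omega
    · have h2 : z i ≤ hi i := hz.2 i
      simp only [Pi.sub_apply]
      rcases hw i with h | h <;> · rw [h]; omega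
    · rw [sub_eq_add_neg, castSite_add', hzq]
      funext κ
      simp [castSite_apply]
  -- a bond `⟨q + w̄, κ⟩` with `w_κ = 0`, `w ∈ {0,1}^d`, does not meet `Λ`
  have hb : ∀ (w : Fin P.d → ℤ) (κ : Fin P.d), (∀ i, w i = 0 ∨ w i = 1) → w κ = 0 →
      ιA (castSite '' Set.Icc lo hi : Set (Site P k)) T X
        ⟨@HAdd.hAdd (Tor (fun _ : Fin P.d => P.sitesPerDir k)) (Tor (fun _ : Fin P.d => P.sitesPerDir k))
          (Tor (fun _ : Fin P.d => P.sitesPerDir k)) _ q (castSite (j := k) w), κ⟩ = 0 := by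
    intro w κ hw hwκ
    apply ιA_apply_of_not_mem
    rw [mem_freeBonds, not_and_or]
    left
    show ¬ (_ ∈ (castSite '' Set.Icc lo hi : Set (Site P k)) ∨ PBond.tgt _ ∈ (castSite '' Set.Icc lo hi : Set (Site P k)))
    rw [not_or]
    refine ⟨key w hw, ?_⟩
    have htgt : (PBond.tgt ⟨@HAdd.hAdd (Tor (fun _ : Fin P.d => P.sitesPerDir k)) (Tor (fun _ : Fin P.d => P.sitesPerDir k))
          (Tor (fun _ : Fin P.d => P.sitesPerDir k)) _ q (castSite (j := k) w), κ⟩ : Site P k)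
        = @HAdd.hAdd (Tor (fun _ : Fin P.d => P.sitesPerDir k)) (Tor (fun _ : Fin P.d => P.sitesPerDir k))
          (Tor (fun _ : Fin P.d => P.sitesPerDir k)) _ q (castSite (j := k) (w + B6BondElimination.unitVec κ)) := by
      show Site.shift _ κ = _
      rw [shift_eq_add_unitVec', castSite_add', castSite_unitVec', add_assoc]
    rw [htgt]
    refine key (w + B6BondElimination.unitVec κ) fun i => ?_
    rw [Pi.add_apply, B6BondElimination.unitVec_apply]
    by_cases hi : i = κ
    · subst hi
      rw [hwκ, if_pos rfl]
      exact Or.inr (by ring)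
    · rw [if_neg hi, add_zero]
      exact hw i
  -- the ℤ^d labels of the four bonds
  have h0 : ∀ i, (0 : Fin P.d → ℤ) i = 0 ∨ (0 : Fin P.d → ℤ) i = 1 := fun i => Or.inl rfl
  have he : ∀ κ i, B6BondElimination.unitVec κ i = 0 ∨ B6BondElimination.unitVec (d := P.d) κ i = 1 := by
    intro κ i
    rw [B6BondElimination.unitVec_apply]
    by_cases hi : i = κ
    · exact Or.inr (if_pos hi)
    · exact Or.inl (if_neg hi)
  have heμν : B6BondElimination.unitVec (d := P.d) μ ν = 0 := by
    rw [B6BondElimination.unitVec_apply, if_neg (Ne.symm hμν)]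
  have heνμ : B6BondElimination.unitVec (d := P.d) ν μ = 0 := by
    rw [B6BondElimination.unitVec_apply, if_neg hμν]
  have hq0 : @HAdd.hAdd (Tor (fun _ : Fin P.d => P.sitesPerDir k)) (Tor (fun _ : Fin P.d => P.sitesPerDir k))
      (Tor (fun _ : Fin P.d => P.sitesPerDir k)) _ q (castSite (j := k) (0 : Fin P.d → ℤ)) = q := by
    funext κ; simp [castSite_apply]
  have t1 := hb 0 μ h0 rfl
  have t4 := hb 0 ν h0 rfl
  have t2 := hb (B6BondElimination.unitVec μ) ν (he μ) heμν
  have t3 := hb (B6BondElimination.unitVec ν) μ (he ν) heνμ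
  rw [hq0] at t1 t4
  rw [castSite_unitVec'] at t2 t3
  rw [plaq_apply]
  simp only [ofRealCfg, t1, t2, t3, t4]
  simp

end Support

/-! ## §4  The root letter fed by the localized Federbush route of `B16Ineq17LocalFederbush` -/

section Flat

variable [DecidableEq (PBond P k)] (n : ℕ) [NeZero n]

/-- ★★ **`h17` AT `γ₀ = 1` FROM FLAT DATA.**  For `X ∈ GaugeSlice S T ℝ³`, a window without wrapping, and — on B5's fine torus
`Tor (fine n Mt)` over `Mt = fun _ => sitesPerDir k` (block side `n = L^k`, corner blocks) — per 𝔤-coordinate `a` a fine field `A_a`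
whose `Q_k`-averages reproduce the coordinate field `X̃_a = ofRealCfg (ιA-coordinates of X)_a` on the plaquettes of a set `S₁` off which
`∂₁X̃_a` vanishes (U2b: `A_a` = the coordinates of `H⁰_{1,k,Z}X`, print (1.3)), a set `T₁` of unit sites containing the four corners of
every plaquette of `S₁` with weights `ζ_{μν} ≥ 0` that are `≥ 1` on its blocks (print (1.6): `ζ₀ ≡ 1` near `Λ`), and a real `Qv`
(`⟪H X, Δ₁(H X)⟫`) with `Qv = Q♭ + E_A`, `Q♭ ≥ Σ_a η^d·½Σ_{μ,ν}Σ_x ζ_{μν}(x)‖F^η_{μν}(A_a)(x)‖²` (U2a: the form «with the background field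
identically equal to 1») and `|E_A| ≤ Cerr·‖X‖²` (letter (b)): `1·circ(X) − Cerr·‖X‖² ≤ Qv`.  No (1.65)–(1.67), no replacement of the
minimiser or of `ζ₀`. [cite: Balaban1989LargeFieldII, (1.6)–(1.7) pp.357–358; Federbush1986PhaseCellI, 'Abelian Stability Theorem' (0.12) p.321] -/
theorem h17_one_of_flat_blocks (h0 : 0 < P.d) {S : Set (Site P k)} {T : Finset (PBond P k)}
    (X : GaugeSlice S T (EuclideanSpace ℝ (Fin 3))) {m : Fin P.d → ℕ} (lo : Fin P.d → ℤ)
    (hm : ∀ κ, (m κ : ℤ) ≤ P.sitesPerDir k)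
    (A : Fin 3 → (Tor (fine n (fun _ : Fin P.d => P.sitesPerDir k)) × Fin P.d → ℂ))
    (S₁ T₁ : Finset (Tor (fun _ : Fin P.d => P.sitesPerDir k)))
    (hS : ∀ a (μ ν : Fin P.d), μ ≠ ν → ∀ q ∉ S₁,
      plaq (fun _ : Fin P.d => P.sitesPerDir k)
        (ofRealCfg (fun _ : Fin P.d => P.sitesPerDir k) fun i => ιA S T X ⟨i.1, i.2⟩ a) μ ν q = 0)
    (hB : ∀ a (μ ν : Fin P.d), μ ≠ ν → ∀ q ∈ S₁,
      plaq (fun _ : Fin P.d => P.sitesPerDir k)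
          (ofRealCfg (fun _ : Fin P.d => P.sitesPerDir k) fun i => ιA S T X ⟨i.1, i.2⟩ a) μ ν q =
        plaq (fun _ : Fin P.d => P.sitesPerDir k) (QvOp n (fun _ : Fin P.d => P.sitesPerDir k) *ᵥ A a) μ ν q)
    (hT : ∀ (μ ν : Fin P.d), μ ≠ ν → ∀ q ∈ S₁,
      q ∈ T₁ ∧ q + B5Prop11Plancherel.unitVec (fun _ : Fin P.d => P.sitesPerDir k) μ ∈ T₁ ∧
        q + B5Prop11Plancherel.unitVec (fun _ : Fin P.d => P.sitesPerDir k) ν ∈ T₁ ∧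
        q + B5Prop11Plancherel.unitVec (fun _ : Fin P.d => P.sitesPerDir k) μ
          + B5Prop11Plancherel.unitVec (fun _ : Fin P.d => P.sitesPerDir k) ν ∈ T₁)
    (ζ : Fin P.d → Fin P.d → Tor (fine n (fun _ : Fin P.d => P.sitesPerDir k)) → ℝ) (hζ0 : ∀ μ ν x, 0 ≤ ζ μ ν x)
    (hζT : ∀ μ ν x, B5Blocks16.blockOf n (fun _ : Fin P.d => P.sitesPerDir k) x ∈ T₁ → 1 ≤ ζ μ ν x)
    {Qv Qflat EA Cerr : ℝ} (hQ : Qv = Qflat + EA)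
    (hflat : ∑ a : Fin 3, 1 / (n : ℝ) ^ P.d * (1 / 2 * ∑ μ : Fin P.d, ∑ ν : Fin P.d, ∑ x,
      ζ μ ν x * ‖Fs (fine n (fun _ : Fin P.d => P.sitesPerDir k)) (n : ℂ) (A a) μ ν x‖ ^ 2) ≤ Qflat)
    (hEA : |EA| ≤ Cerr * ‖X‖ ^ 2) :
    1 * (∑ z ∈ box m lo, ∑ μ : Fin P.d, ∑ a : Fin 3,
        curl (fun b => ιA S T X (⟨castSite b.1, b.2⟩ : PBond P k) a) z ⟨0, h0⟩ μ ^ 2) - Cerr * ‖X‖ ^ 2 ≤ Qv :=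
  h17_one_of_sum_d1Sq_le h0 X lo hm hQ
    ((Finset.sum_le_sum fun a _ => d1Sq_le_weighted_of_blocks n (fun _ : Fin P.d => P.sitesPerDir k) (A a) _ S₁ T₁
      (hS a) (hB a) hT ζ hζ0 hζT).trans hflat) hEA

/-- ★★ **`h17` AT `γ₀ = 1` FROM FLAT DATA, BOX OF RECORD**: `h17_one_of_flat_blocks` for the slice over `pts k Λ = castSite '' Icc lo hi` with
the support hypothesis DISCHARGED by `plaq_ofRealCfg_ιA_eq_zero_of_not_mem`: it suffices that the matching set `S₁` CONTAINS the torus image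
of `Icc (lo − 1) hi` (where `∂₁` of the slice field lives).  Remaining displayed inputs: U2b's matching `hB` on `S₁`, the corner set `T₁`
with print's `ζ₀ ≡ 1` on its blocks (`hT`, `hζT`), U2a's flat form domination `hflat`, letter (b) `hEA`.
[cite: Balaban1989LargeFieldII, (1.6)–(1.8) pp.357–358; Balaban1989LargeFieldI, Prop. 1 (1.77)–(1.78) p.194] -/
theorem h17_one_of_flat_blocks_box (h0 : 0 < P.d) {lo hi : Fin P.d → ℤ} {T : Finset (PBond P k)}
    (X : GaugeSlice (castSite '' Set.Icc lo hi : Set (Site P k)) T (EuclideanSpace ℝ (Fin 3)))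
    {m : Fin P.d → ℕ} (lo' : Fin P.d → ℤ) (hm : ∀ κ, (m κ : ℤ) ≤ P.sitesPerDir k)
    (A : Fin 3 → (Tor (fine n (fun _ : Fin P.d => P.sitesPerDir k)) × Fin P.d → ℂ))
    (S₁ T₁ : Finset (Tor (fun _ : Fin P.d => P.sitesPerDir k)))
    (hS₁ : ∀ q : Tor (fun _ : Fin P.d => P.sitesPerDir k),
      (q : Site P k) ∈ (castSite '' Set.Icc (lo - 1) hi : Set (Site P k)) → q ∈ S₁)
    (hB : ∀ a (μ ν : Fin P.d), μ ≠ ν → ∀ q ∈ S₁,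
      plaq (fun _ : Fin P.d => P.sitesPerDir k)
          (ofRealCfg (fun _ : Fin P.d => P.sitesPerDir k)
            fun i => ιA (castSite '' Set.Icc lo hi : Set (Site P k)) T X ⟨i.1, i.2⟩ a) μ ν q =
        plaq (fun _ : Fin P.d => P.sitesPerDir k) (QvOp n (fun _ : Fin P.d => P.sitesPerDir k) *ᵥ A a) μ ν q)
    (hT : ∀ (μ ν : Fin P.d), μ ≠ ν → ∀ q ∈ S₁,
      q ∈ T₁ ∧ q + B5Prop11Plancherel.unitVec (fun _ : Fin P.d => P.sitesPerDir k) μ ∈ T₁ ∧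
        q + B5Prop11Plancherel.unitVec (fun _ : Fin P.d => P.sitesPerDir k) ν ∈ T₁ ∧
        q + B5Prop11Plancherel.unitVec (fun _ : Fin P.d => P.sitesPerDir k) μ
          + B5Prop11Plancherel.unitVec (fun _ : Fin P.d => P.sitesPerDir k) ν ∈ T₁)
    (ζ : Fin P.d → Fin P.d → Tor (fine n (fun _ : Fin P.d => P.sitesPerDir k)) → ℝ) (hζ0 : ∀ μ ν x, 0 ≤ ζ μ ν x)
    (hζT : ∀ μ ν x, B5Blocks16.blockOf n (fun _ : Fin P.d => P.sitesPerDir k) x ∈ T₁ → 1 ≤ ζ μ ν x)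
    {Qv Qflat EA Cerr : ℝ} (hQ : Qv = Qflat + EA)
    (hflat : ∑ a : Fin 3, 1 / (n : ℝ) ^ P.d * (1 / 2 * ∑ μ : Fin P.d, ∑ ν : Fin P.d, ∑ x,
      ζ μ ν x * ‖Fs (fine n (fun _ : Fin P.d => P.sitesPerDir k)) (n : ℂ) (A a) μ ν x‖ ^ 2) ≤ Qflat)
    (hEA : |EA| ≤ Cerr * ‖X‖ ^ 2) :
    1 * (∑ z ∈ box m lo', ∑ μ : Fin P.d, ∑ a : Fin 3,
        curl (fun b => ιA (castSite '' Set.Icc lo hi : Set (Site P k)) T X (⟨castSite b.1, b.2⟩ : PBond P k) a) z ⟨0, h0⟩ μ ^ 2)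
      - Cerr * ‖X‖ ^ 2 ≤ Qv :=
  h17_one_of_flat_blocks n h0 X lo' hm A S₁ T₁
    (fun a _ _ hμν q hq => plaq_ofRealCfg_ιA_eq_zero_of_not_mem X a hμν fun h => hq (hS₁ q h)) hB hT ζ hζ0 hζT hQ hflat hEA

end Flat

end Literature.MathematicalPhysics.QuantumFieldTheory.Balaban1983to89.B16Ineq17LocalFederbushSlice

end
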